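import Summits.NavierStokesRegularity.FluidComputer.RiccatiComparison
import HarnessLib

/-!
# Fluid computer — support: comparison for the power-law integral inequality `G(b) ≤ G(0) + L ∫₀ᵇ G^{1+q}`

HONEST FRAMING (cell `pub-fluidc`, verbatim): *low prior, high value-of-information experiment on Tao's
machine paradigm; NOT a claim that NS blows up.* Support file (pure real analysis, no fluid content): the ODE
comparison for the integral inequality `G(b) ≤ G(0) + L ∫₀ᵇ G(t)^{1+q} dt` with a real exponent `q > 0` — the
companion of `RiccatiComparison.mul_le_of_sq` (`q = 1`, Cheskidov–Zaya's `y' ≲ y²` at `s = 3/2`) for the Riccati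
laws `y' ≲ y^{(2s+1)/(2s−1)}` of the `Ḣ^s` rows, `3/2 < s < 5/2` (Cheskidov–Zaya 2016, Remark 2.3; there
`q = 2/(2s−1)`): `rpow_mul_le_of_rpow` — `G(b)^q · (1 − q L G(0)^q b) ≤ G(0)^q` on `[0, b₀]`, i.e.
`G(b)^q ≤ G(0)^q/(1 − q L G(0)^q b)` while `q L G(0)^q b < 1` (Bernoulli substitution `H^{−q}`). Read backwards from a
blow-up time: `G(t)^q ≥ 1/(q L (T − t))`. 0 sorry; no definitions.

## References

* A. Cheskidov, K. Zaya, J. Math. Phys. 57 (2016) 023101 = arXiv:1503.01784, Remark 2.3 and Thm. 2.4 (proof).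
  [CheskidovZaya2016]
-/

noncomputable section

open MeasureTheory Set Filter Topology intervalIntegral

namespace Summit.NavierStokesRegularity.FluidComputer.PowerComparison

/-- **Comparison for the power-law integral inequality (Bernoulli majorant).** Let `q > 0`, `L ≥ 0`, let `G` be
continuous and nonnegative on `[0, b₀]` with `G(0) > 0`, and suppose `G(b) ≤ G(0) + L ∫₀ᵇ G(t)^{1+q} dt` for every
`b ∈ [0, b₀]`. Then `G(b)^q · (1 − q L G(0)^q b) ≤ G(0)^q` for every `b ∈ [0, b₀]` — i.e.
`G(b)^q ≤ G(0)^q/(1 − q L G(0)^q b)` while `q L G(0)^q b < 1` (and trivially otherwise). At `q = 1` this is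
`RiccatiComparison.mul_le_of_sq`. [cite: CheskidovZaya2016, Remark 2.3, Thm. 2.4 (proof)] -/
theorem rpow_mul_le_of_rpow {G : ℝ → ℝ} {L b₀ q : ℝ} (hL : 0 ≤ L) (hb₀ : 0 < b₀) (hq : 0 < q)
    (hGc : ContinuousOn G (Icc 0 b₀)) (hG0 : ∀ t ∈ Icc 0 b₀, 0 ≤ G t) (hpos : 0 < G 0)
    (hineq : ∀ b ∈ Icc 0 b₀, G b ≤ G 0 + L * ∫ t in (0 : ℝ)..b, G t ^ (1 + q)) :
    ∀ b ∈ Icc 0 b₀, G b ^ q * (1 - q * L * G 0 ^ q * b) ≤ G 0 ^ q := by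
  intro b hb
  -- the majorant `H(t) = G(0) + L ∫₀ᵗ G^{1+q}`
  set H : ℝ → ℝ := fun t => G 0 + L * ∫ s in (0 : ℝ)..t, G s ^ (1 + q) with hH
  have hG2c : ContinuousOn (fun s => G s ^ (1 + q)) (Icc 0 b₀) :=
    hGc.rpow_const fun t _ => Or.inr (by linarith)
  have hint : ∀ t ∈ Icc 0 b₀, IntervalIntegrable (fun s => G s ^ (1 + q)) volume 0 t := fun t ht =>
    (hG2c.mono (Icc_subset_Icc le_rfl ht.2)).intervalIntegrable_of_Icc ht.1
  have hGH : ∀ t ∈ Icc 0 b₀, G t ≤ H t := fun t ht => hineq t ht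
  have hH0 : H 0 = G 0 := by simp [hH]
  have hHge : ∀ t ∈ Icc 0 b₀, G 0 ≤ H t := by
    intro t ht
    have h0 : 0 ≤ ∫ s in (0 : ℝ)..t, G s ^ (1 + q) :=
      intervalIntegral.integral_nonneg ht.1 fun s hs => Real.rpow_nonneg (hG0 s ⟨hs.1, hs.2.trans ht.2⟩) _
    have : 0 ≤ L * ∫ s in (0 : ℝ)..t, G s ^ (1 + q) := mul_nonneg hL h0
    simp only [hH]
    linarith
  have hHpos : ∀ t ∈ Icc 0 b₀, 0 < H t := fun t ht => hpos.trans_le (hHge t ht)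
  -- continuity of `H` on `[0, b₀]`
  have hHc : ContinuousOn H (Icc 0 b₀) := by
    have hprim : ContinuousOn (fun t => ∫ s in (0 : ℝ)..t, G s ^ (1 + q)) (Icc 0 b₀) := by
      have hIo : IntegrableOn (fun s => G s ^ (1 + q)) (uIcc 0 b₀) volume := by
        rw [uIcc_of_le hb₀.le]
        exact hG2c.integrableOn_Icc
      have h := intervalIntegral.continuousOn_primitive_interval hIo
      rwa [uIcc_of_le hb₀.le] at h
    exact continuousOn_const.add (continuousOn_const.mul hprim)
  -- derivative of `H` in the interior
  have hHd : ∀ t ∈ Ioo 0 b₀, HasDerivAt H (L * G t ^ (1 + q)) t := by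
    intro t ht
    have htI : t ∈ Icc 0 b₀ := Ioo_subset_Icc_self ht
    have hca : ContinuousAt (fun s => G s ^ (1 + q)) t := hG2c.continuousAt (Icc_mem_nhds ht.1 ht.2)
    have hmeas : StronglyMeasurableAtFilter (fun s => G s ^ (1 + q)) (𝓝 t) volume :=
      (hG2c.mono Ioo_subset_Icc_self).stronglyMeasurableAtFilter isOpen_Ioo t ht
    have h1 : HasDerivAt (fun u => ∫ s in (0 : ℝ)..u, G s ^ (1 + q)) (G t ^ (1 + q)) t :=
      intervalIntegral.integral_hasDerivAt_right (hint t htI) hmeas hca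
    exact (h1.const_mul L).const_add (G 0)
  -- the function `φ = -H^{-q}` and its derivative `q L G^{1+q} H^{-q-1} ≤ q L`
  set φ : ℝ → ℝ := fun t => -(H t) ^ (-q) with hφ
  have hφd : ∀ t ∈ Ioo 0 b₀, HasDerivAt φ (q * (L * G t ^ (1 + q)) * H t ^ (-q - 1)) t := by
    intro t ht
    have hHt : 0 < H t := hHpos t (Ioo_subset_Icc_self ht)
    have h2 := ((hHd t ht).rpow_const (p := -q) (Or.inl hHt.ne')).neg
    refine h2.congr_deriv ?_
    ring
  have hφle : ∀ t ∈ Ioo 0 b₀, q * (L * G t ^ (1 + q)) * H t ^ (-q - 1) ≤ q * L := by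
    intro t ht
    have htI : t ∈ Icc 0 b₀ := Ioo_subset_Icc_self ht
    have hHt : 0 < H t := hHpos t htI
    have hGp : G t ^ (1 + q) ≤ H t ^ (1 + q) := Real.rpow_le_rpow (hG0 t htI) (hGH t htI) (by linarith)
    have hHH : H t ^ (1 + q) * H t ^ (-q - 1) = 1 := by
      rw [← Real.rpow_add hHt, show (1 + q + (-q - 1)) = (0 : ℝ) by ring, Real.rpow_zero]
    calc q * (L * G t ^ (1 + q)) * H t ^ (-q - 1) = q * L * (G t ^ (1 + q) * H t ^ (-q - 1)) := by ring
      _ ≤ q * L * (H t ^ (1 + q) * H t ^ (-q - 1)) := by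
          refine mul_le_mul_of_nonneg_left ?_ (mul_nonneg hq.le hL)
          exact mul_le_mul_of_nonneg_right hGp (Real.rpow_nonneg hHt.le _)
      _ = q * L := by rw [hHH, mul_one]
  -- mean value inequality on `[0, b]`
  have hφc : ContinuousOn φ (Icc 0 b) := by
    have hHc' : ContinuousOn H (Icc 0 b) := hHc.mono (Icc_subset_Icc le_rfl hb.2)
    refine (hHc'.rpow_const fun t ht => Or.inl ?_).neg
    exact (hHpos t ⟨ht.1, ht.2.trans hb.2⟩).ne'
  have hφdiff : DifferentiableOn ℝ φ (interior (Icc 0 b)) := by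
    rw [interior_Icc]
    intro t ht
    exact (hφd t ⟨ht.1, ht.2.trans_le hb.2⟩).differentiableAt.differentiableWithinAt
  have hφ' : ∀ t ∈ interior (Icc 0 b), deriv φ t ≤ q * L := by
    rw [interior_Icc]
    intro t ht
    have ht' : t ∈ Ioo 0 b₀ := ⟨ht.1, ht.2.trans_le hb.2⟩
    rw [(hφd t ht').deriv]
    exact hφle t ht'
  have hmv := (convex_Icc 0 b).image_sub_le_mul_sub_of_deriv_le hφc hφdiff hφ' 0 (left_mem_Icc.2 hb.1) b
    (right_mem_Icc.2 hb.1) hb.1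
  -- `φ b - φ 0 ≤ q L b`, i.e. `G(0)^{-q} - H(b)^{-q} ≤ q L b`
  have hHb : 0 < H b := hHpos b hb
  have hφ0 : φ 0 = -(G 0) ^ (-q) := by simp only [hφ, hH0]
  have hφb : φ b = -(H b) ^ (-q) := rfl
  rw [hφ0, hφb, sub_zero] at hmv
  have hmv' : (G 0) ^ (-q) - (H b) ^ (-q) ≤ q * L * b := by linarith
  -- conclude
  by_cases hD : 1 - q * L * G 0 ^ q * b ≤ 0
  · calc G b ^ q * (1 - q * L * G 0 ^ q * b) ≤ 0 :=
        mul_nonpos_of_nonneg_of_nonpos (Real.rpow_nonneg (hG0 b hb) _) hD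
      _ ≤ G 0 ^ q := Real.rpow_nonneg hpos.le _
  · rw [not_le] at hD
    have hG0q : 0 < G 0 ^ q := Real.rpow_pos_of_pos hpos _
    have hHbq : 0 < H b ^ q := Real.rpow_pos_of_pos hHb _
    have hinv0 : (G 0) ^ (-q) = (G 0 ^ q)⁻¹ := Real.rpow_neg hpos.le q
    have hinvb : (H b) ^ (-q) = (H b ^ q)⁻¹ := Real.rpow_neg hHb.le q
    rw [hinv0, hinvb] at hmv'
    -- `(G0^q)⁻¹ (1 - qL G0^q b) ≤ (H b^q)⁻¹`, hence `H b^q (1 - …) ≤ G0^q`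
    have key : H b ^ q * (1 - q * L * G 0 ^ q * b) ≤ G 0 ^ q := by
      have h1 : (G 0 ^ q)⁻¹ * (1 - q * L * G 0 ^ q * b) ≤ (H b ^ q)⁻¹ := by
        have e1 : (G 0 ^ q)⁻¹ * (1 - q * L * G 0 ^ q * b) = (G 0 ^ q)⁻¹ - q * L * b := by
          field_simp
        rw [e1]
        linarith
      have h2 := mul_le_mul_of_nonneg_left h1 (mul_nonneg hG0q.le hHbq.le)
      have e2 : G 0 ^ q * H b ^ q * ((G 0 ^ q)⁻¹ * (1 - q * L * G 0 ^ q * b)) =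
          H b ^ q * (1 - q * L * G 0 ^ q * b) := by field_simp
      have e3 : G 0 ^ q * H b ^ q * (H b ^ q)⁻¹ = G 0 ^ q := by field_simp
      rwa [e2, e3] at h2
    have hGb : G b ^ q ≤ H b ^ q := Real.rpow_le_rpow (hG0 b hb) (hGH b hb) hq.le
    calc G b ^ q * (1 - q * L * G 0 ^ q * b) ≤ H b ^ q * (1 - q * L * G 0 ^ q * b) :=
        mul_le_mul_of_nonneg_right hGb hD.le
      _ ≤ G 0 ^ q := key

end Summit.NavierStokesRegularity.FluidComputer.PowerComparison

end
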